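import Literature.AlgebraicGeometry.Resolution.AbhyankarEtaleAscentProofs
import Literature.AlgebraicGeometry.Resolution.KnafKuhlmann2005Thm34HenselRoot
import Literature.AlgebraicGeometry.Resolution.AbhyankarRationalUniformization
import Literature.AlgebraicGeometry.Resolution.KnafKuhlmann2009Prop23
import Literature.AlgebraicGeometry.Resolution.ValuedFunctionFieldsLemmas
import Summits.ResolutionOfSingularities.ResolutionOfSingularities.Theorems.ValuativeLuAlphaPTorsorHenselRootChart
import Summits.ResolutionOfSingularities.ResolutionOfSingularities.Theorems.ValuativeLuAlphaPTorsorAdaptedDefs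
import Summits.ResolutionOfSingularities.ResolutionOfSingularities.Theorems.ValuativeLuAlphaPTorsorAdaptedHenselRootChartHelpers
import Mathlib.FieldTheory.Minpoly.IsIntegrallyClosed
import Mathlib.RingTheory.Polynomial.UniqueFactorization
import Mathlib.RingTheory.Polynomial.RationalRoot
import Mathlib.RingTheory.Polynomial.ScaleRoots
import HarnessLib

/-!
# Adapted Hensel-root charts: assembly of the chart

Crux `Valuative.LuAlphaPTorsor` (item `stmt-ResolutionOfSingularities-0641`), line
`pfaff-line-log-final-forms`, registered stub `stub_adaptedHenselRootChart` (F3, reshape v6.3);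
registered helper sub-goal `adHensel_hi_small`.

* `adHensel_hi_small` — (C2a) of `AdaptedValues` makes the parameters of level `≥ ℓ` smaller
  than every Laurent monomial of level `< ℓ`.
* `adHensel_core` — (C3), inclusion `⊇`: on a `k`-subalgebra `R = k[x, η, 1/A] ⊆ O` all of whose
  elements are `G(x; η) A^{-N}`, containing the inverse of the level-`ℓ` cofactor `a`
  (`…AdaptedHenselRootChartLevel`), every `z ∈ R` smaller than all Laurent monomials of level
  `< ℓ` lies in `(x_{≥ℓ}) R`: `G(x; η) ≡ G(x_{<ℓ}, 0; η) (mod (x_{≥ℓ}) R)` and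
  `G(x_{<ℓ}, 0; η) = F(x_{<ℓ}, 0; η) w / a ∈ (x_{≥ℓ}) R` as `F(x; η) = 0`.
* `adHensel_assembly` — the ring `R = k[x, η, 1/A]`, `A` the product of the level cofactors, is
  an ADAPTED chart (`AdaptedChart`): (C3) at every level by `adHensel_core` (levels above the
  top one coincide with it), the centre clause being (C3) at level `0`; `R` lies in every
  subfield containing `k`, the `xᵢ` and `η`.
-/

-- single-problem summit: the doubled namespace component `ResolutionOfSingularities` is forced
set_option linter.dupNamespace false

namespace Summit.ResolutionOfSingularities.ResolutionOfSingularities.Theorems.PfaffLine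

open IsLocalRing Polynomial Literature.AlgebraicGeometry.Resolution

/-! ### Assembly of the adapted chart -/

/-- **Registered anchor.** The variables of level `≥ ℓ` are smaller than every Laurent
monomial of level `< ℓ` (from (C2a) applied to a low index of maximal level, or from `v(xᵢ) < 1` if there is none).
[folklore] -/
theorem adHensel_hi_small :
    ∀ (K : Type) [Field K] (O : ValuationSubring K) (n : ℕ) (x : Fin n → K) (lv : Fin n → ℕ), (∀ i, O.valuation (x i) < 1) → (∀ i i', lv i < lv i' → ∀ m : Fin n → ℤ, (∀ j, lv i < lv j → m j = 0) → O.valuation (x i') < ∏ j, O.valuation (x j) ^ (m j)) → ∀ (ℓ : ℕ) (i : Fin n), ℓ ≤ lv i → ∀ m : Fin n → ℤ, (∀ j, ℓ ≤ lv j → m j = 0) → O.valuation (x i) < ∏ j, O.valuation (x j) ^ (m j) := by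
  intro K _ O n x lv hvx hC2a ℓ i hi m hm
  classical
  by_cases hlow : ∃ j, lv j < ℓ
  · obtain ⟨j₁, hj₁⟩ := hlow
    obtain ⟨j₀, hj₀, hmax⟩ := (Finset.univ.filter fun j => lv j < ℓ).exists_max_image lv
      ⟨j₁, by simpa using hj₁⟩
    rw [Finset.mem_filter] at hj₀
    refine hC2a j₀ i (lt_of_lt_of_le hj₀.2 hi) m fun j hj => ?_
    by_cases hjl : lv j < ℓ
    · exact absurd (hmax j (by simpa using hjl)) (not_le.mpr hj)
    · exact hm j (not_lt.mp hjl)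
  · push Not at hlow
    have hm0 : m = 0 := funext fun j => hm j (hlow j)
    rw [hm0]
    simp only [Pi.zero_apply, zpow_zero, Finset.prod_const_one]
    exact hvx i

/-- **(C3), inclusion `⊇`, on a ring with enough units.** In the situation of `adHensel_level`,
let `R ⊆ O` be a `k`-subalgebra containing the `xᵢ`, `η`, the inverse of an `O`-unit `A` such
that every element of `R` is `G(x; η) A^{-N}`, and the inverse of the level-`ℓ` cofactor `a`.
Then every `z ∈ R` smaller than all Laurent monomials of level `< ℓ` lies in the ideal of `R`
generated by the variables of level `≥ ℓ`. [folklore] -/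
theorem adHensel_core {k K : Type} [Field k] [Field K] [Algebra k K] (O : ValuationSubring K)
    {n : ℕ} (x : Fin n → K) (hx0 : ∀ i, x i ≠ 0)
    (lv : Fin n → ℕ) (ℓ : ℕ)
    (hhi : ∀ i, ℓ ≤ lv i → ∀ m : Fin n → ℤ, (∀ j, ℓ ≤ lv j → m j = 0) →
      O.valuation (x i) < ∏ j, O.valuation (x j) ^ (m j))
    (η : K) (F : (MvPolynomial (Fin n) k)[X]) (hF0 : F.eval₂ (MvPolynomial.aeval x).toRingHom η = 0)
    (R : Subalgebra k K) (hRO : ∀ z ∈ R, z ∈ O) (hxR : ∀ i, x i ∈ R) (hηR : η ∈ R)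
    {A : K} (hA0 : A ≠ 0) (hvA : O.valuation A = 1) (hAR : A⁻¹ ∈ R)
    (hgen : ∀ z ∈ R, ∃ (N : ℕ) (G : (MvPolynomial (Fin n) k)[X]),
      z = G.eval₂ (MvPolynomial.aeval x).toRingHom η * A⁻¹ ^ N)
    {a : K} (ha0 : a ≠ 0) (haR : a⁻¹ ∈ R)
    (hkey : ∀ G : (MvPolynomial (Fin n) k)[X],
      (∀ m : Fin n → ℤ, (∀ j, ℓ ≤ lv j → m j = 0) →
        O.valuation (G.eval₂ (MvPolynomial.aeval fun i => if lv i < ℓ then x i else 0).toRingHom η) <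
          ∏ j, O.valuation (x j) ^ (m j)) →
      ∃ w ∈ Algebra.adjoin k (Set.range x ∪ {η}),
        G.eval₂ (MvPolynomial.aeval fun i => if lv i < ℓ then x i else 0).toRingHom η * a =
          F.eval₂ (MvPolynomial.aeval fun i => if lv i < ℓ then x i else 0).toRingHom η * w)
    {z : K} (hz : z ∈ R)
    (hsmall : ∀ m : Fin n → ℤ, (∀ j, ℓ ≤ lv j → m j = 0) →
      O.valuation z < ∏ j, O.valuation (x j) ^ (m j)) :
    z ∈ {z | ∃ r : Fin n → K, (∀ i, r i ∈ R) ∧ z = ∑ i, r i * (if lv i < ℓ then 0 else x i)} := by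
  classical
  set xlo : Fin n → K := fun i => if lv i < ℓ then x i else 0 with hxlo
  have hadjR : Algebra.adjoin k (Set.range x ∪ {η}) ≤ R :=
    Algebra.adjoin_le (Set.union_subset (Set.range_subset_iff.mpr hxR)
      (Set.singleton_subset_iff.mpr hηR))
  obtain ⟨N, G, hzG⟩ := hgen z hz
  have hGz : G.eval₂ (MvPolynomial.aeval x).toRingHom η = z * A ^ N := by
    rw [hzG, mul_assoc, ← mul_pow, inv_mul_cancel₀ hA0, one_pow, mul_one]
  have hcongr : ∀ G : (MvPolynomial (Fin n) k)[X],
      G.eval₂ (MvPolynomial.aeval x).toRingHom η - G.eval₂ (MvPolynomial.aeval xlo).toRingHom η ∈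
        {z | ∃ r : Fin n → K, (∀ i, r i ∈ R) ∧ z = ∑ i, r i * (if lv i < ℓ then 0 else x i)} := by
    intro G
    rw [← eval_map, ← eval_map]
    refine adHensel_eval_sub_eval_mem_sp hηR fun i => ?_
    rw [coeff_map, coeff_map]
    exact adHensel_aeval_sub_aeval_lo_mem_sp x lv ℓ R (fun c => R.algebraMap_mem c) hxR (G.coeff i)
  have hsGlo : ∀ m : Fin n → ℤ, (∀ j, ℓ ≤ lv j → m j = 0) →
      O.valuation (G.eval₂ (MvPolynomial.aeval xlo).toRingHom η) < ∏ j, O.valuation (x j) ^ (m j) := by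
    have h := adHensel_small_of_mem_sp O x hx0 lv ℓ hhi hRO (hcongr G)
    intro m hm
    have e : G.eval₂ (MvPolynomial.aeval xlo).toRingHom η = G.eval₂ (MvPolynomial.aeval x).toRingHom η -
        (G.eval₂ (MvPolynomial.aeval x).toRingHom η - G.eval₂ (MvPolynomial.aeval xlo).toRingHom η) := by
      ring
    rw [e]
    refine lt_of_le_of_lt (Valuation.map_sub _ _ _) (max_lt ?_ (h m hm))
    rw [hGz, map_mul, map_pow, hvA, one_pow, mul_one]
    exact hsmall m hm
  obtain ⟨w, hw, hGw⟩ := hkey G hsGlo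
  have hFlo : F.eval₂ (MvPolynomial.aeval xlo).toRingHom η ∈
      {z | ∃ r : Fin n → K, (∀ i, r i ∈ R) ∧ z = ∑ i, r i * (if lv i < ℓ then 0 else x i)} := by
    have h := hcongr F
    rw [hF0, zero_sub] at h
    simpa using neg_mem_sp h
  have hGlo : G.eval₂ (MvPolynomial.aeval xlo).toRingHom η ∈
      {z | ∃ r : Fin n → K, (∀ i, r i ∈ R) ∧ z = ∑ i, r i * (if lv i < ℓ then 0 else x i)} := by
    have e : G.eval₂ (MvPolynomial.aeval xlo).toRingHom η =
        F.eval₂ (MvPolynomial.aeval xlo).toRingHom η * w * a⁻¹ := by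
      rw [← hGw, mul_assoc, mul_inv_cancel₀ ha0, mul_one]
    rw [e]
    exact mul_mem_sp_right (mul_mem_sp_right hFlo (hadjR hw)) haR
  have hGx : G.eval₂ (MvPolynomial.aeval x).toRingHom η ∈
      {z | ∃ r : Fin n → K, (∀ i, r i ∈ R) ∧ z = ∑ i, r i * (if lv i < ℓ then 0 else x i)} := by
    have e : G.eval₂ (MvPolynomial.aeval x).toRingHom η =
        (G.eval₂ (MvPolynomial.aeval x).toRingHom η - G.eval₂ (MvPolynomial.aeval xlo).toRingHom η) +
          G.eval₂ (MvPolynomial.aeval xlo).toRingHom η := by ring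
    rw [e]
    exact add_mem_sp (hcongr G) hGlo
  rw [hzG]
  exact mul_mem_sp_right hGx (pow_mem hAR N)


/-- **The adapted chart of a Hensel root.** For `x₁, …, xₙ ∈ 𝔪_O ∖ 0` with `ℤ`-independent
adapted values and `η ∈ O` a root of `F ∈ k[X][T]` that has a unit level cofactor at every
level (hypothesis `hlevel`, supplied by `adHensel_level` when `F` is monic and its reduction
`F(0; T)` has the residue of `η` as a simple root), the ring `R = k[x, η, 1/A]`, `A` the product
of the level cofactors, is an ADAPTED chart with parameters `x`: every `z ∈ R` is
`G(x; η) A^{-N}`, and (C3) at each level follows from `adHensel_core`; the centre clause is (C3)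
at level `0`. `R` lies in every subfield containing `k`, the `xᵢ` and `η`. [folklore] -/
theorem adHensel_assembly {k K : Type} [Field k] [Field K] [Algebra k K] (O : ValuationSubring K)
    (hk : ∀ c : k, algebraMap k K c ∈ O) {n : ℕ} (x : Fin n → K) (hx0 : ∀ i, x i ≠ 0)
    (hvx : ∀ i, O.valuation (x i) < 1)
    (hxi : ∀ m : Fin n → ℤ, (∏ i, O.valuation (x i) ^ (m i)) = 1 → m = 0)
    (lv : Fin n → ℕ) (hAV : AdaptedValues (fun i => O.valuation (x i)) lv)
    {η : K} (hη : η ∈ O) (F : (MvPolynomial (Fin n) k)[X])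
    (hF0 : F.eval₂ (MvPolynomial.aeval x).toRingHom η = 0)
    (hlevel : ∀ ℓ : ℕ, ∃ a ∈ Algebra.adjoin k (Set.range x ∪ {η}), O.valuation a = 1 ∧
      ∀ G : (MvPolynomial (Fin n) k)[X],
        (∀ m : Fin n → ℤ, (∀ j, ℓ ≤ lv j → m j = 0) →
          O.valuation (G.eval₂ (MvPolynomial.aeval fun i => if lv i < ℓ then x i else 0).toRingHom η) <
            ∏ j, O.valuation (x j) ^ (m j)) →
        ∃ w ∈ Algebra.adjoin k (Set.range x ∪ {η}),
          G.eval₂ (MvPolynomial.aeval fun i => if lv i < ℓ then x i else 0).toRingHom η * a =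
            F.eval₂ (MvPolynomial.aeval fun i => if lv i < ℓ then x i else 0).toRingHom η * w) :
    ∃ (R : Subalgebra k K) (hRO : R.toSubring ≤ O.toSubring) (hx : ∀ i, x i ∈ R),
      η ∈ R ∧ (∀ T : Subfield K, Set.range (algebraMap k K) ⊆ T → (∀ i, x i ∈ T) → η ∈ T →
        (R : Set K) ⊆ T) ∧ AdaptedChart O R hRO x hx lv := by
  classical
  have hxO : ∀ i, x i ∈ O := fun i => (O.valuation_le_one_iff _).mp (hvx i).le
  have hv0 : ∀ j, O.valuation (x j) ≠ 0 := fun j => (map_ne_zero O.valuation).mpr (hx0 j)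
  have hprod0 : ∀ m : Fin n → ℤ, (∏ j, O.valuation (x j) ^ (m j)) ≠ 0 := fun m =>
    Finset.prod_ne_zero_iff.mpr fun j _ => zpow_ne_zero _ (hv0 j)
  have hhi : ∀ (ℓ : ℕ) (i : Fin n), ℓ ≤ lv i → ∀ m : Fin n → ℤ, (∀ j, ℓ ≤ lv j → m j = 0) →
      O.valuation (x i) < ∏ j, O.valuation (x j) ^ (m j) :=
    adHensel_hi_small K O n x lv hvx hAV.1
  -- the level cofactors and the ring `R = k[x, η, 1/A]`
  choose a haB hva hkey using hlevel
  have ha0 : ∀ ℓ, a ℓ ≠ 0 := fun ℓ h0 => by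
    have h := hva ℓ
    rw [h0, map_zero] at h
    exact zero_ne_one h
  set L : ℕ := Finset.univ.sup lv + 1 with hL
  have hlvL : ∀ i, lv i < L := fun i => Nat.lt_succ_of_le (Finset.le_sup (Finset.mem_univ i))
  set A : K := ∏ ℓ ∈ Finset.range (L + 1), a ℓ with hA
  have hvA : O.valuation A = 1 := by
    rw [hA, map_prod]
    exact Finset.prod_eq_one fun ℓ _ => hva ℓ
  have hA0 : A ≠ 0 := fun h0 => by
    rw [h0, map_zero] at hvA
    exact zero_ne_one hvA
  have hAO : A⁻¹ ∈ O := (O.valuation_le_one_iff _).mp (by rw [map_inv₀, hvA, inv_one])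
  set B : Subalgebra k K := Algebra.adjoin k (Set.range x ∪ {η}) with hB
  have hAB : A ∈ B := prod_mem fun ℓ _ => haB ℓ
  set R : Subalgebra k K := Algebra.adjoin k (Set.range x ∪ {η, A⁻¹}) with hR
  have hBR : B ≤ R :=
    Algebra.adjoin_mono (Set.union_subset_union_right _ (Set.singleton_subset_iff.mpr
      (Set.mem_insert _ _)))
  have hxR : ∀ i, x i ∈ R := fun i => Algebra.subset_adjoin (Or.inl ⟨i, rfl⟩)
  have hηR : η ∈ R := Algebra.subset_adjoin (Or.inr (Set.mem_insert _ _))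
  have hAR : A⁻¹ ∈ R := Algebra.subset_adjoin (Or.inr (Set.mem_insert_of_mem _ rfl))
  have hRO' : ∀ z ∈ R, z ∈ O := adjoin_le_of_mem O hk (by
    rintro _ (⟨i, rfl⟩ | h)
    · exact hxO i
    · rcases h with rfl | rfl
      exacts [hη, hAO])
  have hRO : R.toSubring ≤ O.toSubring := fun z hz => hRO' z hz
  have haR : ∀ ℓ ∈ Finset.range (L + 1), (a ℓ)⁻¹ ∈ R := by
    intro ℓ hℓ
    have hP : A = a ℓ * ∏ ℓ' ∈ (Finset.range (L + 1)).erase ℓ, a ℓ' :=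
      (Finset.mul_prod_erase _ _ hℓ).symm
    have e : (a ℓ)⁻¹ = A⁻¹ * ∏ ℓ' ∈ (Finset.range (L + 1)).erase ℓ, a ℓ' := by
      rw [hP, mul_inv, mul_assoc, inv_mul_cancel₀ (Finset.prod_ne_zero_iff.mpr
        fun ℓ' _ => ha0 ℓ'), mul_one]
    rw [e]
    exact mul_mem hAR (prod_mem fun ℓ' _ => hBR (haB ℓ'))
  -- every element of `R` is `G(x; η) / A^N`
  have hBpoly : ∀ b ∈ B, ∃ G : (MvPolynomial (Fin n) k)[X],
      G.eval₂ (MvPolynomial.aeval x).toRingHom η = b := by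
    intro b hb
    refine Algebra.adjoin_induction (fun s hs => ?_) (fun c => ?_)
      (fun _ _ _ _ h₁ h₂ => ?_) (fun _ _ _ _ h₁ h₂ => ?_) hb
    · rcases hs with ⟨i, rfl⟩ | hs
      · refine ⟨Polynomial.C (MvPolynomial.X i), ?_⟩
        rw [eval₂_C]
        exact MvPolynomial.aeval_X _ _
      · rw [Set.mem_singleton_iff] at hs
        rw [hs]
        exact ⟨X, eval₂_X _ _⟩
    · refine ⟨Polynomial.C (MvPolynomial.C c), ?_⟩
      rw [eval₂_C]
      exact MvPolynomial.algHom_C _ _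
    · obtain ⟨G₁, h₁⟩ := h₁
      obtain ⟨G₂, h₂⟩ := h₂
      exact ⟨G₁ + G₂, by rw [eval₂_add, h₁, h₂]⟩
    · obtain ⟨G₁, h₁⟩ := h₁
      obtain ⟨G₂, h₂⟩ := h₂
      exact ⟨G₁ * G₂, by rw [eval₂_mul, h₁, h₂]⟩
  obtain ⟨GA, hGA⟩ := hBpoly A hAB
  have hgen : ∀ z ∈ R, ∃ (N : ℕ) (G : (MvPolynomial (Fin n) k)[X]),
      z = G.eval₂ (MvPolynomial.aeval x).toRingHom η * A⁻¹ ^ N := by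
    intro z hz
    refine Algebra.adjoin_induction (fun s hs => ?_) (fun c => ?_)
      (fun _ _ _ _ h₁ h₂ => ?_) (fun _ _ _ _ h₁ h₂ => ?_) hz
    · rcases hs with ⟨i, rfl⟩ | hs
      · refine ⟨0, Polynomial.C (MvPolynomial.X i), ?_⟩
        rw [eval₂_C, pow_zero, mul_one]
        exact (MvPolynomial.aeval_X _ _).symm
      · rcases hs with rfl | rfl
        · exact ⟨0, X, by rw [eval₂_X, pow_zero, mul_one]⟩
        · exact ⟨1, 1, by rw [eval₂_one, one_mul, pow_one]⟩
    · refine ⟨0, Polynomial.C (MvPolynomial.C c), ?_⟩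
      rw [eval₂_C, pow_zero, mul_one]
      exact (MvPolynomial.algHom_C _ _).symm
    · obtain ⟨N₁, G₁, h₁⟩ := h₁
      obtain ⟨N₂, G₂, h₂⟩ := h₂
      refine ⟨N₁ + N₂, G₁ * GA ^ N₂ + G₂ * GA ^ N₁, ?_⟩
      rw [h₁, h₂, eval₂_add, eval₂_mul, eval₂_mul, eval₂_pow, eval₂_pow, hGA, pow_add]
      have hu : A * A⁻¹ = 1 := mul_inv_cancel₀ hA0
      generalize G₁.eval₂ (MvPolynomial.aeval x).toRingHom η = g₁
      generalize G₂.eval₂ (MvPolynomial.aeval x).toRingHom η = g₂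
      calc g₁ * A⁻¹ ^ N₁ + g₂ * A⁻¹ ^ N₂
          = g₁ * (A * A⁻¹) ^ N₂ * A⁻¹ ^ N₁ + g₂ * (A * A⁻¹) ^ N₁ * A⁻¹ ^ N₂ := by
            rw [hu, one_pow, one_pow, mul_one, mul_one]
        _ = (g₁ * A ^ N₂ + g₂ * A ^ N₁) * (A⁻¹ ^ N₁ * A⁻¹ ^ N₂) := by
            rw [mul_pow, mul_pow]
            ring
    · obtain ⟨N₁, G₁, h₁⟩ := h₁
      obtain ⟨N₂, G₂, h₂⟩ := h₂
      refine ⟨N₁ + N₂, G₁ * G₂, ?_⟩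
      rw [h₁, h₂, eval₂_mul]
      ring
  -- the key property at every level (levels `> L` coincide with level `L`)
  have hkey' : ∀ ℓ, ∃ b : K, b ≠ 0 ∧ b⁻¹ ∈ R ∧ ∀ G : (MvPolynomial (Fin n) k)[X],
      (∀ m : Fin n → ℤ, (∀ j, ℓ ≤ lv j → m j = 0) →
        O.valuation (G.eval₂ (MvPolynomial.aeval fun i => if lv i < ℓ then x i else 0).toRingHom η) <
          ∏ j, O.valuation (x j) ^ (m j)) →
      ∃ w ∈ Algebra.adjoin k (Set.range x ∪ {η}),
        G.eval₂ (MvPolynomial.aeval fun i => if lv i < ℓ then x i else 0).toRingHom η * b =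
          F.eval₂ (MvPolynomial.aeval fun i => if lv i < ℓ then x i else 0).toRingHom η * w := by
    intro ℓ
    by_cases hℓ : ℓ ≤ L
    · exact ⟨a ℓ, ha0 ℓ, haR ℓ (Finset.mem_range.mpr (Nat.lt_succ_of_le hℓ)), hkey ℓ⟩
    · rw [not_le] at hℓ
      refine ⟨a L, ha0 L, haR L (Finset.mem_range.mpr (Nat.lt_succ_self L)), fun G hG => ?_⟩
      have hlo : (fun i => if lv i < ℓ then x i else 0) = fun i => if lv i < L then x i else 0 :=
        funext fun i => by rw [if_pos (hlvL i), if_pos ((hlvL i).trans hℓ)]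
      rw [hlo] at hG ⊢
      exact hkey L G fun m _ => hG m fun j hj => absurd (hlvL j) (not_lt.mpr (hℓ.le.trans hj))
  -- (C3)
  have hC3 : ∀ (ℓ : ℕ) (z : R.toSubring),
      z ∈ Ideal.span (Set.range fun i : {i : Fin n // ℓ ≤ lv i} => (⟨x i.1, hxR i.1⟩ : R.toSubring)) ↔
        ∀ m : Fin n → ℤ, (∀ j, ℓ ≤ lv j → m j = 0) →
          O.valuation (z : K) < ∏ j, O.valuation (x j) ^ (m j) := by
    intro ℓ z
    constructor
    · intro hz
      refine Submodule.span_induction (p := fun (z : R.toSubring) _ => ∀ m : Fin n → ℤ,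
          (∀ j, ℓ ≤ lv j → m j = 0) → O.valuation (z : K) < ∏ j, O.valuation (x j) ^ (m j))
        ?_ ?_ ?_ ?_ hz
      · rintro _ ⟨i, rfl⟩ m hm
        exact hhi ℓ i.1 i.2 m hm
      · intro m _
        rw [ZeroMemClass.coe_zero, map_zero]
        exact zero_lt_iff.mpr (hprod0 m)
      · intro a b _ _ ha hb m hm
        rw [AddMemClass.coe_add]
        exact Valuation.map_add_lt _ (ha m hm) (hb m hm)
      · intro r a _ ha m hm
        rw [smul_eq_mul, MulMemClass.coe_mul, map_mul]
        exact mul_lt_of_le_one_of_lt ((O.valuation_le_one_iff _).mpr (hRO' _ r.2)) (ha m hm)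
    · intro hsm
      obtain ⟨b, hb0, hbR, hkeyb⟩ := hkey' ℓ
      obtain ⟨r, hr, hzr⟩ := adHensel_core O x hx0 lv ℓ (hhi ℓ) η F hF0 R hRO' hxR hηR hA0 hvA
        hAR hgen hb0 hbR hkeyb z.2 hsm
      rw [Ideal.mem_span_range_iff_exists_fun]
      refine ⟨fun i => ⟨r i.1, hr i.1⟩, Subtype.ext ?_⟩
      have h := map_sum R.toSubring.subtype
        (fun i : {i : Fin n // ℓ ≤ lv i} => (⟨r i.1, hr i.1⟩ : R.toSubring) * ⟨x i.1, hxR i.1⟩)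
        Finset.univ
      simp only [map_mul, Subring.coe_subtype] at h
      rw [h, hzr, ← Fintype.sum_subtype_add_sum_subtype (fun j => ℓ ≤ lv j)
        (fun i => r i * (if lv i < ℓ then 0 else x i))]
      rw [show (∑ i : {j : Fin n // ¬ ℓ ≤ lv j}, r i.1 * (if lv i.1 < ℓ then 0 else x i.1)) = 0 from
        Finset.sum_eq_zero fun i _ => by rw [if_pos (not_le.mp i.2), mul_zero], add_zero]
      exact Finset.sum_congr rfl fun i _ => by rw [if_neg (not_lt.mpr i.2)]
  -- the centre clause is (C3) at level `0`
  have hcentre : Ideal.span (Set.range fun i => (⟨x i, hxR i⟩ : R.toSubring)) =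
      Ideal.comap (Subring.inclusion hRO) (maximalIdeal O) := by
    have hset : (Set.range fun i => (⟨x i, hxR i⟩ : R.toSubring)) =
        Set.range fun i : {i : Fin n // 0 ≤ lv i} => (⟨x i.1, hxR i.1⟩ : R.toSubring) := by
      ext z
      constructor
      · rintro ⟨i, rfl⟩
        exact ⟨⟨i, Nat.zero_le _⟩, rfl⟩
      · rintro ⟨i, rfl⟩
        exact ⟨i.1, rfl⟩
    ext z
    rw [hset, hC3 0 z, Ideal.mem_comap]
    constructor
    · intro h
      refine (ValuationSubring.valuation_lt_one_iff O _).mpr ?_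
      have h1 := h 0 (fun _ _ => rfl)
      simp only [Pi.zero_apply, zpow_zero, Finset.prod_const_one] at h1
      exact h1
    · intro h m hm
      have hm0 : m = 0 := funext fun j => hm j (Nat.zero_le _)
      rw [hm0]
      simp only [Pi.zero_apply, zpow_zero, Finset.prod_const_one]
      have h1 := (ValuationSubring.valuation_lt_one_iff O _).mp h
      exact h1
  have hRfg : R.FG :=
    Subalgebra.fg_def.mpr ⟨Set.range x ∪ {η, A⁻¹}, (Set.finite_range x).union (Set.toFinite _), rfl⟩
  refine ⟨R, hRO, hxR, hηR, fun T hkT hxT hηT => ?_,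
    (adaptedChart_iff O R hRO x hxR lv).mpr ⟨hRfg, hx0, hcentre, hxi, hAV, hC3⟩⟩
  have hkT' : ∀ c : k, algebraMap k K c ∈ T := fun c => hkT ⟨c, rfl⟩
  have hBT : ∀ b ∈ B, b ∈ T := adjoin_le_of_mem T hkT' (by
    rintro _ (⟨i, rfl⟩ | h)
    · exact hxT i
    · rw [Set.mem_singleton_iff] at h
      rw [h]
      exact hηT)
  exact adjoin_le_of_mem T hkT' (by
    rintro _ (⟨i, rfl⟩ | h)
    · exact hxT i
    · rcases h with rfl | rfl
      exacts [hηT, inv_mem (hBT A hAB)])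

end Summit.ResolutionOfSingularities.ResolutionOfSingularities.Theorems.PfaffLine
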